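import Summits.Ventures.LatticeQCDFlow.Scaling.ReplicaExchangeFiniteSampler
import Literature.Probability.MarkovChains.BottleneckRatioSpectralGap
import Literature.Probability.MarkovChains.AsymptoticVarianceSpectral

/-!
HONEST FRAMING: exact (Metropolis-corrected) sampling algorithms for lattice gauge theory; figures
of merit are autocorrelation/cost numbers at stated couplings and volumes; no continuum-physics
claim.

# ReplicaExchangeModeTorpid — REPLICA EXCHANGE CANNOT CHANGE HOW MANY REPLICAS SIT IN A SECTOR; ONLY THE
# WITHIN-REPLICA UPDATES DO, ONE REPLICA AT A TIME: `Gap ≤ (1−t)·Σ_k Q_k(A,Aᶜ)/((K+1)·Σ_k μ_k(A)μ_k(Aᶜ))` AND THE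
# CENTRED SECTOR COUNT HAS `τ_int ≥ (K+1)Σ_k μ_k(A)μ_k(Aᶜ)/((1−t)Σ_k Q_k(A,Aᶜ)) − ½` (lean-2 GEN-17, ours)

Venture-side (OURS).  Cell `lqcd-flow` (pub-lqcd), unit `pub-lqcd-lean-2-g17`, 2026-08-25.  The replica-exchange
(parallel-tempering / PTBC-type) companion of `Scaling/SimulatedTemperingModeTorpid`.  Setting of
`Scaling/ReplicaExchangeFiniteSampler` (chapter X): finite configuration space `S`, levels `μ_k` (positive
probability vectors), within-level updates `M_k` (row-stochastic, `μ_k`-reversible); state `(τ, x)` = (tag, one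
configuration per level), target `ptFinLaw μ (τ,x) = (K+1)⁻¹·Π_k μ_k(x_k)`; the sampler
`P = ptFinSampler t μ M = t·ptFinSwap μ + (1−t)·ptFinUpdate M` (Metropolis swap of a uniformly chosen adjacent pair /
update of a uniformly chosen replica).  For a set of configurations `A : Finset S` (a mode, a topological sector)
the observable is the CENTRED SECTOR COUNT `G(τ,x) = Σ_k f_k(x_k)`, `f_k = f_A^{(μ_k)}` the Literature's
`bottleneckTestFun (μ k) A` (`= 1_{Aᶜ} − μ_k(Aᶜ)`, an affine function of the number of replicas in `A`).

## What is proved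

* §1 (product-law tools on `Fin (K+1) → S`): `sum_tensorFun_mul_two` (two-coordinate marginal, `i ≠ l`);
  **`piInner_tensorFun_additive`** — for coordinatewise MEAN-ZERO `g_k`, `‖Σ_k g_k(x_k)‖²_π̃ = Σ_k ‖g_k‖²_{μ_k}`;
  **`dirichletForm_prodKernel_additive`** — `𝓔_π̃(prodKernel w M; Σ_k g_k(x_k)) = Σ_k w_k·𝓔_{μ_k}(M_k; g_k)`.
* §2 **`ptFin_dirichletForm_swap_sectorCount`** — THE SWAP MOVE IS INVISIBLE TO `G` (`𝓔_{Sw}(G) = 0`);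
  **`ptFin_dirichletForm_sectorCount`** — `𝓔_P(G) = ((1−t)/(K+1))·Σ_k Q_k(A,Aᶜ)` EXACTLY;
  `ptFin_piInner_sectorCount` (`‖G‖² = Σ_k μ_k(A)μ_k(Aᶜ)`), `ptFin_mean_sectorCount` (`E_π G = 0`).
* §3 **`ptFin_spectralGap_le_sector`** — `Gap(P) ≤ (1−t)·Σ_k Q_k(A,Aᶜ)/((K+1)·Σ_k μ_k(A)μ_k(Aᶜ))` (Rayleigh
  quotient + Levin–Peres–Wilmer Lemma 13.7, PROVED in the tree; `0 ≤ t ≤ 1`, `K ≥ 1`, `Σ_k μ_k(A)μ_k(Aᶜ) > 0`);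
  **`ptFin_tauInt_sectorCount_ge`** — for an irreducible sampler, `τ_int(G) = asympVar/(2Var) ≥
  (K+1)·Σ_k μ_k(A)μ_k(Aᶜ)/((1−t)Σ_k Q_k(A,Aᶜ)) − ½` (Madras–Slade Prop. 9.2.2 route).

Reading (no numerics implied): a swap never creates or destroys a configuration of sector `A`; the number of replicas
in `A` changes only when a within-replica update crosses the sector boundary (stationary rate
`(1/(K+1))Σ_k Q_k(A,Aᶜ)` per step); levels where the sector is frozen or weightless contribute nothing — replica
exchange decorrelates a sector only through levels where it both PERSISTS and TUNNELS, as for simulated tempering.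
NOT CLAIMED: sharpness; the positive direction for replica exchange (modes as blocks of the product chain); general
configuration spaces; anything measured.  Literature grade (cell rule): KNOWN MECHANISM (test-function gap ceilings;
torpid mixing of parallel tempering from persistence — Woodard–Schmidler–Huber, Electron. J. Probab. 14 (2009)
780–804; Bhatnagar–Randall 2004), NEW TYPING (exact Dirichlet-form identity for the sector count); nothing cited as a
fact; no new bib keys.
-/

noncomputable section

open Finset Function
open Literature.Probability.MarkovChains

namespace Summit.Ventures.LatticeQCDFlow.Scaling

variable {S : Type*} [Fintype S] [DecidableEq S] {K : ℕ}

/-! ## §1 Product-law tools: two-coordinate marginal, additive observables -/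

section Product

variable (μ : Fin (K + 1) → S → ℝ)

omit [DecidableEq S] in
/-- **Two-coordinate marginal of the product law:** `Σ_x π̃(x)·g(x_i)·h(x_l) = (Σ_u μ_i(u)g(u))·(Σ_v μ_l(v)h(v))` for
`i ≠ l` (all `μ_k` of mass one). [folklore] -/
theorem sum_tensorFun_mul_two (hμ1 : ∀ k, ∑ u, μ k u = 1) {i l : Fin (K + 1)} (hil : i ≠ l) (g h : S → ℝ) :
    ∑ x : Fin (K + 1) → S, tensorFun μ x * (g (x i) * h (x l))
      = (∑ u, μ i u * g u) * ∑ v, μ l v * h v := by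
  set χ : Fin (K + 1) → S → ℝ := fun k u => if k = i then g u else if k = l then h u else 1 with hχ
  have h1 : (univ.filter fun k : Fin (K + 1) => k = i) = {i} := by ext k; simp
  have h2 : ((univ.filter fun k : Fin (K + 1) => ¬k = i).filter fun k => k = l) = {l} := by
    ext k; simp only [Finset.mem_filter, Finset.mem_univ, true_and, Finset.mem_singleton]
    exact ⟨fun hk => hk.2, fun hk => ⟨hk ▸ (Ne.symm hil), hk⟩⟩
  have hχx : ∀ x : Fin (K + 1) → S, tensorFun χ x = g (x i) * h (x l) := by
    intro x
    unfold tensorFun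
    rw [Finset.prod_ite, Finset.prod_ite, h1, h2, Finset.prod_singleton, Finset.prod_singleton,
      Finset.prod_const_one, mul_one]
  have hprod : ∀ x : Fin (K + 1) → S, tensorFun μ x * (g (x i) * h (x l))
      = tensorFun (fun k u => μ k u * χ k u) x := fun x => by rw [← hχx, tensorFun_mul]
  simp_rw [hprod]
  rw [sum_tensorFun, Finset.prod_congr rfl fun k _ => show (∑ u, μ k u * χ k u)
      = (if k = i then ∑ u, μ i u * g u else if k = l then ∑ v, μ l v * h v else 1) from by
    by_cases hki : k = i
    · subst hki; simp [hχ]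
    · by_cases hkl : k = l
      · subst hkl; simp [hχ, hki]
      · simp [hχ, hki, hkl, hμ1 k]]
  rw [Finset.prod_ite, Finset.prod_ite, h1, h2, Finset.prod_singleton, Finset.prod_singleton, Finset.prod_const_one,
    mul_one]

omit [DecidableEq S] in
/-- **Additive observables with mean-zero summands are orthogonal sums:** for `E_{μ_k}[g_k] = 0`,
`‖Σ_k g_k(x_k)‖²_π̃ = Σ_k ‖g_k‖²_{μ_k}`. [folklore] -/
theorem piInner_tensorFun_additive (hμ1 : ∀ k, ∑ u, μ k u = 1) (g : Fin (K + 1) → S → ℝ)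
    (hg0 : ∀ k, ∑ u, μ k u * g k u = 0) :
    piInner (tensorFun μ) (fun x => ∑ k, g k (x k)) (fun x => ∑ k, g k (x k))
      = ∑ k, piInner (μ k) (g k) (g k) := by
  unfold piInner
  have hsq : ∀ x : Fin (K + 1) → S, tensorFun μ x * ((∑ k, g k (x k)) * ∑ k, g k (x k))
      = ∑ k, ∑ l, tensorFun μ x * (g k (x k) * g l (x l)) := by
    intro x
    rw [Finset.sum_mul_sum, Finset.mul_sum]
    exact sum_congr rfl fun k _ => by rw [Finset.mul_sum]
  simp_rw [hsq]
  rw [Finset.sum_comm]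
  refine sum_congr rfl fun k _ => ?_
  rw [Finset.sum_comm, ← Finset.sum_erase_add univ _ (mem_univ k)]
  have hdiag : ∑ x : Fin (K + 1) → S, tensorFun μ x * (g k (x k) * g k (x k)) = ∑ u, μ k u * (g k u * g k u) :=
    sum_tensorFun_mul_apply μ hμ1 k (fun u => g k u * g k u)
  have hoff : ∑ l ∈ univ.erase k, ∑ x : Fin (K + 1) → S, tensorFun μ x * (g k (x k) * g l (x l)) = 0 := by
    refine Finset.sum_eq_zero fun l hl => ?_
    rw [sum_tensorFun_mul_two μ hμ1 (Finset.ne_of_mem_erase hl).symm, hg0 l, mul_zero]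
  rw [hoff, hdiag, zero_add]

omit [DecidableEq S] in
/-- The mean of an additive observable is the sum of the coordinate means. [folklore] -/
theorem sum_tensorFun_mul_additive (hμ1 : ∀ k, ∑ u, μ k u = 1) (g : Fin (K + 1) → S → ℝ) :
    ∑ x : Fin (K + 1) → S, tensorFun μ x * ∑ k, g k (x k) = ∑ k, ∑ u, μ k u * g k u := by
  simp_rw [Finset.mul_sum]
  rw [Finset.sum_comm]
  exact sum_congr rfl fun k _ => sum_tensorFun_mul_apply μ hμ1 k (g k)

/-- **One replica moves at a time:** `𝓔_π̃(prodKernel w M; Σ_k g_k(x_k)) = Σ_k w_k·𝓔_{μ_k}(M_k; g_k)`. [folklore] -/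
theorem dirichletForm_prodKernel_additive (hμ1 : ∀ k, ∑ u, μ k u = 1) (w : Fin (K + 1) → ℝ)
    (M : Fin (K + 1) → S → S → ℝ) (g : Fin (K + 1) → S → ℝ) :
    dirichletForm (tensorFun μ) (prodKernel w M) (fun x => ∑ k, g k (x k))
      = ∑ k, w k * dirichletForm (μ k) (M k) (g k) := by
  unfold dirichletForm
  have hupd : ∀ (x : Fin (K + 1) → S) (k : Fin (K + 1)) (v : S),
      (∑ j, g j (x j)) - ∑ j, g j (update x k v j) = g k (x k) - g k v := by
    intro x k v
    have e1 : ∑ j, g j (x j) = g k (x k) + ∑ j ∈ univ.erase k, g j (x j) :=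
      (Finset.add_sum_erase univ (fun j => g j (x j)) (mem_univ k)).symm
    have e2 : ∑ j, g j (update x k v j) = g k v + ∑ j ∈ univ.erase k, g j (x j) := by
      rw [← Finset.add_sum_erase univ (fun j => g j (update x k v j)) (mem_univ k)]
      simp only [update_self]
      congr 1
      exact sum_congr rfl fun j hj => by rw [update_of_ne (Finset.ne_of_mem_erase hj)]
    rw [e1, e2]
    ring
  have hinner : ∀ x : Fin (K + 1) → S,
      ∑ y, tensorFun μ x * prodKernel w M x y * ((∑ j, g j (x j)) - ∑ j, g j (y j)) ^ 2
        = tensorFun μ x * ∑ k, w k * ∑ v, M k (x k) v * (g k (x k) - g k v) ^ 2 := by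
    intro x
    simp_rw [mul_assoc]
    rw [← Finset.mul_sum, sum_prodKernel_mul M w x (fun y => ((∑ j, g j (x j)) - ∑ j, g j (y j)) ^ 2)]
    congr 1
    refine sum_congr rfl fun k _ => ?_
    congr 1
    refine sum_congr rfl fun v _ => ?_
    rw [hupd]
  simp_rw [hinner]
  have step1 : (∑ x : Fin (K + 1) → S, tensorFun μ x * ∑ k, w k * ∑ v, M k (x k) v * (g k (x k) - g k v) ^ 2)
      = ∑ k, w k * ∑ u, μ k u * ∑ v, M k u v * (g k u - g k v) ^ 2 := by
    calc (∑ x : Fin (K + 1) → S, tensorFun μ x * ∑ k, w k * ∑ v, M k (x k) v * (g k (x k) - g k v) ^ 2)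
        = ∑ x : Fin (K + 1) → S, ∑ k, w k * (tensorFun μ x * ∑ v, M k (x k) v * (g k (x k) - g k v) ^ 2) := by
          refine sum_congr rfl fun x _ => ?_
          rw [Finset.mul_sum]
          exact sum_congr rfl fun k _ => by ring
      _ = ∑ k, ∑ x : Fin (K + 1) → S, w k * (tensorFun μ x * ∑ v, M k (x k) v * (g k (x k) - g k v) ^ 2) :=
          Finset.sum_comm
      _ = ∑ k, w k * ∑ u, μ k u * ∑ v, M k u v * (g k u - g k v) ^ 2 := by
          refine sum_congr rfl fun k _ => ?_
          rw [← Finset.mul_sum, sum_tensorFun_mul_apply μ hμ1 k (fun u => ∑ v, M k u v * (g k u - g k v) ^ 2)]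
  rw [step1, Finset.mul_sum]
  refine sum_congr rfl fun k _ => ?_
  rw [mul_left_comm]
  congr 1
  congr 1
  refine sum_congr rfl fun u _ => ?_
  rw [Finset.mul_sum]
  exact sum_congr rfl fun v _ => by ring

end Product

/-! ## §2 The centred sector count: the swap is invisible, the update moves one replica -/

section Sector

variable {μ : Fin (K + 1) → S → ℝ} {M : Fin (K + 1) → S → S → ℝ} {t : ℝ}

/-- The Literature's centred indicator `f_A^{(ν)} = 1_{Aᶜ} − ν(Aᶜ)` for a probability vector `ν`. [ours] -/
theorem bottleneckTestFun_eq {ν : S → ℝ} (hν1 : ∑ u, ν u = 1) (A : Finset S) (u : S) :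
    bottleneckTestFun ν A u = (if u ∈ A then 0 else 1) - ∑ y ∈ Aᶜ, ν y := by
  unfold bottleneckTestFun
  have hc : ∑ y ∈ A, ν y + ∑ y ∈ Aᶜ, ν y = 1 := by rw [Finset.sum_add_sum_compl, hν1]
  split_ifs <;> linarith

/-- **A swap permutes the replicas, so it does not change the centred sector count.** [ours] -/
theorem sectorCount_swapAct (hμ1 : ∀ k, ∑ u, μ k u = 1) (A : Finset S) (j : Fin K)
    (p : Fin (K + 1) × (Fin (K + 1) → S)) :
    ∑ k, bottleneckTestFun (μ k) A ((swapAct j p).2 k) = ∑ k, bottleneckTestFun (μ k) A (p.2 k) := by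
  simp_rw [bottleneckTestFun_eq (hμ1 _)]
  rw [Finset.sum_sub_distrib, Finset.sum_sub_distrib]
  congr 1
  unfold swapAct
  exact Equiv.sum_comp (levelSwap j) (fun i => if p.2 i ∈ A then (0 : ℝ) else 1)

/-- **The swap move's Dirichlet form of the sector count vanishes.** [ours] -/
theorem ptFin_dirichletForm_swap_sectorCount (hμ : ∀ k x, 0 < μ k x) (hμ1 : ∀ k, ∑ u, μ k u = 1) (A : Finset S) :
    dirichletForm (ptFinLaw μ) (ptFinSwap μ) (fun p => ∑ k, bottleneckTestFun (μ k) A (p.2 k)) = 0 := by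
  unfold dirichletForm
  rw [mul_eq_zero]
  refine Or.inr (Finset.sum_eq_zero fun p _ => Finset.sum_eq_zero fun q _ => ?_)
  by_cases hqp : q = p
  · rw [hqp, sub_self]; ring
  · rw [ptFinLaw_mul_ptFinSwap hμ hqp]
    unfold ptFinProposal
    rw [Finset.sum_mul, Finset.sum_mul]
    refine Finset.sum_eq_zero fun j _ => ?_
    split_ifs with hj
    · rw [hj]
      beta_reduce
      rw [sectorCount_swapAct hμ1, sub_self]
      ring
    · ring

omit [DecidableEq S] in
/-- Summing `F(x)` against the replica-exchange target over all states gives the `π̃`-sum of `F`. [ours] -/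
theorem sum_ptFinLaw_mul_snd (F : (Fin (K + 1) → S) → ℝ) :
    ∑ p : Fin (K + 1) × (Fin (K + 1) → S), ptFinLaw μ p * F p.2 = ∑ x, tensorFun μ x * F x := by
  rw [Fintype.sum_prod_type]
  unfold ptFinLaw
  simp only
  rw [Finset.sum_const, Finset.card_univ, Fintype.card_fin, nsmul_eq_mul]
  rw [Finset.mul_sum]
  refine sum_congr rfl fun x _ => ?_
  push_cast
  field_simp

/-- **The replica update's Dirichlet form of the sector count:** `𝓔_{Upd}(G) = (1/(K+1))·Σ_k Q_k(A,Aᶜ)` — one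
uniformly chosen replica moves, and `𝓔_{μ_k}(M_k; f_A^{(μ_k)}) = Q_k(A,Aᶜ)`. [ours] -/
theorem ptFin_dirichletForm_update_sectorCount (hμ1 : ∀ k, ∑ u, μ k u = 1) (hM : ∀ k, IsRowStochastic (M k))
    (hMrev : ∀ k, DetailedBalance (μ k) (M k)) (A : Finset S) :
    dirichletForm (ptFinLaw μ) (ptFinUpdate M) (fun p => ∑ k, bottleneckTestFun (μ k) A (p.2 k))
      = 1 / (K + 1) * ∑ k, edgeMeasure (μ k) (M k) A Aᶜ := by
  have h1 : dirichletForm (ptFinLaw μ) (ptFinUpdate M) (fun p => ∑ k, bottleneckTestFun (μ k) A (p.2 k))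
      = dirichletForm (tensorFun μ) (prodKernel (fun _ : Fin (K + 1) => (1 : ℝ) / (K + 1)) M)
          (fun x => ∑ k, bottleneckTestFun (μ k) A (x k)) := by
    unfold dirichletForm
    congr 1
    have inner : ∀ p : Fin (K + 1) × (Fin (K + 1) → S),
        ∑ q : Fin (K + 1) × (Fin (K + 1) → S), ptFinLaw μ p * ptFinUpdate M p q
            * ((∑ k, bottleneckTestFun (μ k) A (p.2 k)) - ∑ k, bottleneckTestFun (μ k) A (q.2 k)) ^ 2
          = ptFinLaw μ p * ∑ y, prodKernel (fun _ : Fin (K + 1) => (1 : ℝ) / (K + 1)) M p.2 y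
            * ((∑ k, bottleneckTestFun (μ k) A (p.2 k)) - ∑ k, bottleneckTestFun (μ k) A (y k)) ^ 2 := by
      intro p
      rw [Fintype.sum_prod_type, Finset.mul_sum]
      simp_rw [ptFinUpdate_apply]
      rw [Finset.sum_eq_single p.1 (fun τ _ hτ => by simp [hτ]) (fun h => absurd (mem_univ _) h)]
      simp only [if_true]
      exact sum_congr rfl fun y _ => by ring
    simp_rw [inner]
    rw [sum_ptFinLaw_mul_snd (μ := μ) (fun x => ∑ y, prodKernel (fun _ : Fin (K + 1) => (1 : ℝ) / (K + 1)) M x y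
      * ((∑ k, bottleneckTestFun (μ k) A (x k)) - ∑ k, bottleneckTestFun (μ k) A (y k)) ^ 2)]
    refine sum_congr rfl fun x _ => ?_
    rw [Finset.mul_sum]
    exact sum_congr rfl fun y _ => by ring
  rw [h1, dirichletForm_prodKernel_additive μ hμ1, ← Finset.mul_sum]
  congr 1
  refine sum_congr rfl fun k _ => ?_
  exact dirichletForm_bottleneckTestFun (hM k) ((hMrev k).isStationary (hM k).2) (hμ1 k) A

/-- **THE SAMPLER'S DIRICHLET FORM OF THE SECTOR COUNT: `𝓔_P(G) = ((1−t)/(K+1))·Σ_k Q_k(A,Aᶜ)` EXACTLY.** [ours] -/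
theorem ptFin_dirichletForm_sectorCount (hμ : ∀ k x, 0 < μ k x) (hμ1 : ∀ k, ∑ u, μ k u = 1)
    (hM : ∀ k, IsRowStochastic (M k)) (hMrev : ∀ k, DetailedBalance (μ k) (M k)) (A : Finset S) :
    dirichletForm (ptFinLaw μ) (ptFinSampler t μ M) (fun p => ∑ k, bottleneckTestFun (μ k) A (p.2 k))
      = (1 - t) / (K + 1) * ∑ k, edgeMeasure (μ k) (M k) A Aᶜ := by
  have hlin : dirichletForm (ptFinLaw μ) (ptFinSampler t μ M) (fun p => ∑ k, bottleneckTestFun (μ k) A (p.2 k))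
      = t * dirichletForm (ptFinLaw μ) (ptFinSwap μ) (fun p => ∑ k, bottleneckTestFun (μ k) A (p.2 k))
        + (1 - t) * dirichletForm (ptFinLaw μ) (ptFinUpdate M) (fun p => ∑ k, bottleneckTestFun (μ k) A (p.2 k)) := by
    unfold dirichletForm
    rw [← mul_assoc, ← mul_assoc, mul_comm t, mul_comm (1 - t), mul_assoc, mul_assoc, ← mul_add]
    congr 1
    rw [Finset.mul_sum, Finset.mul_sum, ← Finset.sum_add_distrib]
    refine sum_congr rfl fun p _ => ?_
    rw [Finset.mul_sum, Finset.mul_sum, ← Finset.sum_add_distrib]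
    refine sum_congr rfl fun q _ => ?_
    rw [ptFinSampler_apply]
    ring
  rw [hlin, ptFin_dirichletForm_swap_sectorCount hμ hμ1, ptFin_dirichletForm_update_sectorCount hμ1 hM hMrev,
    mul_zero, zero_add]
  ring

omit [DecidableEq S] in
/-- **The sector count is centred:** `Σ_p π(p)G(p) = 0`. [ours] -/
theorem ptFin_mean_sectorCount [DecidableEq S] (hμ1 : ∀ k, ∑ u, μ k u = 1) (A : Finset S) :
    ∑ p : Fin (K + 1) × (Fin (K + 1) → S), ptFinLaw μ p * ∑ k, bottleneckTestFun (μ k) A (p.2 k) = 0 := by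
  rw [sum_ptFinLaw_mul_snd (μ := μ) (fun x => ∑ k, bottleneckTestFun (μ k) A (x k)),
    sum_tensorFun_mul_additive μ hμ1]
  exact Finset.sum_eq_zero fun k _ => sum_mul_bottleneckTestFun (μ k) A

/-- **The sector count's square norm:** `‖G‖²_π = Σ_k μ_k(A)μ_k(Aᶜ)`. [ours] -/
theorem ptFin_piInner_sectorCount (hμ1 : ∀ k, ∑ u, μ k u = 1) (A : Finset S) :
    piInner (ptFinLaw μ) (fun p => ∑ k, bottleneckTestFun (μ k) A (p.2 k))
        (fun p => ∑ k, bottleneckTestFun (μ k) A (p.2 k))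
      = ∑ k, (∑ x ∈ A, μ k x) * ∑ x ∈ Aᶜ, μ k x := by
  unfold piInner
  rw [sum_ptFinLaw_mul_snd (μ := μ)
    (fun x => (∑ k, bottleneckTestFun (μ k) A (x k)) * ∑ k, bottleneckTestFun (μ k) A (x k))]
  have h := piInner_tensorFun_additive μ hμ1 (fun k => bottleneckTestFun (μ k) A)
    (fun k => sum_mul_bottleneckTestFun (μ k) A)
  unfold piInner at h
  rw [h]
  exact sum_congr rfl fun k _ => piInner_bottleneckTestFun (hμ1 k) A

/-! ## §3 The spectral-gap ceiling and the autocorrelation floor -/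

/-- **THE GAP CEILING FOR REPLICA EXCHANGE: `Gap(P) ≤ (1−t)·Σ_k Q_k(A,Aᶜ)/((K+1)·Σ_k μ_k(A)μ_k(Aᶜ))`** for every set
of configurations that is uncertain at some level (`Σ_k μ_k(A)μ_k(Aᶜ) > 0`), `0 ≤ t ≤ 1`, `K ≥ 1`. [ours] -/
theorem ptFin_spectralGap_le_sector (hK : 1 ≤ K) (hμ : ∀ k x, 0 < μ k x) (hμ1 : ∀ k, ∑ u, μ k u = 1)
    (hM : ∀ k, IsRowStochastic (M k)) (hMrev : ∀ k, DetailedBalance (μ k) (M k)) (ht0 : 0 ≤ t) (ht1 : t ≤ 1)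
    (A : Finset S) (hA : 0 < ∑ k, (∑ x ∈ A, μ k x) * ∑ x ∈ Aᶜ, μ k x) :
    spectralGap (ptFinLaw μ) (ptFinSampler t μ M)
      ≤ (1 - t) * (∑ k, edgeMeasure (μ k) (M k) A Aᶜ) / ((K + 1) * ∑ k, (∑ x ∈ A, μ k x) * ∑ x ∈ Aᶜ, μ k x) := by
  haveI : Nonempty S := ⟨Classical.choice (by
    by_contra h
    rw [not_nonempty_iff] at h
    have := hμ1 0
    rw [Finset.univ_eq_empty, Finset.sum_empty] at this
    exact zero_ne_one this)⟩
  haveI : Nontrivial (Fin (K + 1)) := Fin.nontrivial_iff_two_le.mpr (by omega)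
  have hP := ptFinSampler_isRowStochastic (M := M) hμ hM ht0 ht1
  have hDB := ptFinSampler_detailedBalance (t := t) (M := M) hμ hMrev
  have hray := LevinPeres2017_lemma_13_7_rayleigh (ptFinLaw_pos hμ) (sum_ptFinLaw hμ1) hP hDB
    (ptFin_mean_sectorCount (μ := μ) hμ1 A)
  rw [ptFin_piInner_sectorCount hμ1, ptFin_dirichletForm_sectorCount hμ hμ1 hM hMrev] at hray
  rw [le_div_iff₀ (by positivity)]
  have hK1 : (0 : ℝ) < K + 1 := by positivity
  calc spectralGap (ptFinLaw μ) (ptFinSampler t μ M) * ((K + 1) * ∑ k, (∑ x ∈ A, μ k x) * ∑ x ∈ Aᶜ, μ k x)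
      = (K + 1) * (spectralGap (ptFinLaw μ) (ptFinSampler t μ M)
          * ∑ k, (∑ x ∈ A, μ k x) * ∑ x ∈ Aᶜ, μ k x) := by ring
    _ ≤ (K + 1) * ((1 - t) / (K + 1) * ∑ k, edgeMeasure (μ k) (M k) A Aᶜ) :=
        mul_le_mul_of_nonneg_left hray hK1.le
    _ = (1 - t) * ∑ k, edgeMeasure (μ k) (M k) A Aᶜ := by field_simp

/-- **THE SECTOR COUNT STAYS CORRELATED:** for an irreducible sampler (`0 ≤ t < 1`) and a set uncertain at some
level, `τ_int(G) = asympVar/(2Var) ≥ (K+1)·Σ_k μ_k(A)μ_k(Aᶜ)/((1−t)·Σ_k Q_k(A,Aᶜ)) − ½`. [ours] -/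
theorem ptFin_tauInt_sectorCount_ge (hμ : ∀ k x, 0 < μ k x) (hμ1 : ∀ k, ∑ u, μ k u = 1)
    (hM : ∀ k, IsRowStochastic (M k)) (hMrev : ∀ k, DetailedBalance (μ k) (M k)) (ht0 : 0 ≤ t) (ht1 : t < 1)
    (hirr : IsIrreducible (ptFinSampler t μ M)) (A : Finset S)
    (hA : 0 < ∑ k, (∑ x ∈ A, μ k x) * ∑ x ∈ Aᶜ, μ k x) :
    (K + 1) * (∑ k, (∑ x ∈ A, μ k x) * ∑ x ∈ Aᶜ, μ k x) / ((1 - t) * ∑ k, edgeMeasure (μ k) (M k) A Aᶜ) - 1 / 2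
      ≤ asympVar (fun p => ∑ k, bottleneckTestFun (μ k) A (p.2 k)) (ptFinLaw μ) (ptFinSampler t μ M)
          / (2 * lawVariance (ptFinLaw μ) (fun p => ∑ k, bottleneckTestFun (μ k) A (p.2 k))) := by
  set G : Fin (K + 1) × (Fin (K + 1) → S) → ℝ := fun p => ∑ k, bottleneckTestFun (μ k) A (p.2 k) with hG
  have hP := ptFinSampler_isRowStochastic (M := M) hμ hM ht0 ht1.le
  have hDB := ptFinSampler_detailedBalance (t := t) (M := M) hμ hMrev
  have hst : IsStationary (ptFinLaw μ) (ptFinSampler t μ M) := hDB.isStationary hP.2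
  have hπ := ptFinLaw_pos (K := K) hμ
  have hπ1 := sum_ptFinLaw (K := K) hμ1
  have hmean : lawMean (ptFinLaw μ) G = 0 := ptFin_mean_sectorCount (μ := μ) hμ1 A
  have hVar : lawVariance (ptFinLaw μ) G = ∑ k, (∑ x ∈ A, μ k x) * ∑ x ∈ Aᶜ, μ k x := by
    rw [← ptFin_piInner_sectorCount hμ1 A]
    unfold lawVariance piInner
    rw [hmean]
    exact sum_congr rfl fun p _ => by ring
  have hE : dirichletForm (ptFinLaw μ) (ptFinSampler t μ M) G = (1 - t) / (K + 1) * ∑ k, edgeMeasure (μ k) (M k) A Aᶜ :=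
    ptFin_dirichletForm_sectorCount hμ hμ1 hM hMrev A
  -- Madras–Slade: `V(V + C₁) ≤ v(V − C₁)` with `V − C₁ = 𝓔`
  have key := asympVar_mul_dirichletForm_ge hπ hπ1 hP hDB hirr G
  have h928 := MadrasSlade1993_eq_9_2_28 hP hst G
  set V := lawVariance (ptFinLaw μ) G with hVdef
  set C1 := piInner (ptFinLaw μ) (centred (ptFinLaw μ) G) ((ptFinSampler t μ M).mulVec (centred (ptFinLaw μ) G))
  set v := asympVar G (ptFinLaw μ) (ptFinSampler t μ M)
  set E := dirichletForm (ptFinLaw μ) (ptFinSampler t μ M) G with hEdef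
  have hC1E : C1 = V - E := by linarith
  rw [hC1E] at key
  have hVpos : 0 < V := by rw [hVar]; exact hA
  -- `E > 0` (else `2V² ≤ 0`)
  have hEpos : 0 < E := by
    by_contra h
    push Not at h
    have hE0 : E = 0 := le_antisymm h (dirichletForm_nonneg (fun p => (hπ p).le) hP.1 _)
    rw [hE0, sub_zero] at key
    nlinarith
  have hK1 : (0 : ℝ) < K + 1 := by positivity
  have hQpos : 0 < ∑ k, edgeMeasure (μ k) (M k) A Aᶜ := by
    rw [hE] at hEpos
    exact (mul_pos_iff_of_pos_left (div_pos (by linarith) hK1)).mp hEpos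
  have eL : (K + 1) * (∑ k, (∑ x ∈ A, μ k x) * ∑ x ∈ Aᶜ, μ k x) / ((1 - t) * ∑ k, edgeMeasure (μ k) (M k) A Aᶜ)
      = V / E := by
    rw [hVar, hE]
    have h1t : (1 - t) ≠ 0 := by linarith
    field_simp
  rw [eL]
  have e : V / E - 1 / 2 = (2 * V - E) / (2 * E) := by field_simp
  rw [e, div_le_div_iff₀ (by positivity) (by positivity)]
  nlinarith [key]

end Sector

end Summit.Ventures.LatticeQCDFlow.Scaling

end
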